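import Summits.ABC.ABC.Theses.IsogenyGlueCongruence
import Summits.ABC.ABC.Theorems.SharpDegreeOfPolyDegree.Negative.ExponentFloor
import Summits.ABC.ABC.Theorems.SharpDegreeOfPolyDegree.Negative.LogicalPosition
import Summits.ABC.ABC.Theorems.IsogenyGlueCongruenceSharpDegreeOfPolyDegreeOfTarget

set_option linter.dupNamespace false

/-!
# Strategy census (crux-strategist s1) — crux stmt-ABC-10895 `SharpDegreeOfPolyDegree` (R = Poly → X)

Kernel-checked companions of `STRATEGY-CENSUS.md` (strategist seat
`planner-cstrat-stmt-ABC-10895-s1-0`, 2026-08-17).  `R := SharpDegreeOfPolyDegree`,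
`X := SemistableDegreeConjecture`, `DegAt κ` := the polynomial modular-degree bound with exponent `κ`
(so `Poly = ∃ κ, DegAt κ` and `X = ∀ ε > 0, DegAt (2 + ε)`, both definitionally).

* `## Strengthen` — the strengthen-to-induct form of the crux, `ExponentDescent`
  ("every fixed-exponent bound descends by every fixed step `δ > 0`"), is EQUIVALENT to `R`
  (`exponentDescent_iff_sharpDegreeOfPolyDegree`): the induction merely re-indexes the crux, each
  descent step `DegAt κ → DegAt (κ − δ)` being an instance of the same exponent drop.
* `## Decomposition` — the best typed split found, along the `max(|Δ|, |c₄|³)` seam of generalized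
  Szpiro (`DiscSharpOfPoly`, `SharpOfDiscSharp`), glues to `R` by a ONE-LINE seam
  (`sharpDegreeOfPolyDegree_of_split`), i.e. it is a trivial cut, and `R` also splits trivially
  along any exponent ladder (`sharpDegreeOfPolyDegree_of_ladder`).
* `## Negation` — pointers only: `¬R ↔ Poly ∧ ¬X` (`Negative.LogicalPosition`), the vacuous line
  `¬Poly → R` (`sharpDegreeOfPolyDegree_of_not_poly`), the exponent floor (`Negative.ExponentFloor`).

No `sorry`; theorems only besides the three bookkeeping abbreviations.
-/

noncomputable section

namespace Summit.ABC.ABC.Cruxes.SharpDegreeOfPolyDegree.Strategist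

open Summit.ABC.ABC.Theses.IsogenyGlueCongruence
open Literature.NumberTheory.EllipticCurves Literature.NumberTheory.EllipticCurves.ModularForms
open WeierstrassCurve

/-- The polynomial modular-degree bound for semistable curves with exponent `κ`
(verbatim the matrix of the crux's antecedent). -/
def DegAt (κ : ℝ) : Prop :=
  ∃ C : ℝ, ∀ (W : WeierstrassCurve ℚ) [W.IsElliptic] [W.IsGloballyMinimal]
    [NeZero (W.conductorNorm ℤ)], W.IsSemistable ℤ →
      ∃ D : ModularParametrizationData W (W.conductorNorm ℤ),
        (D.modularDegree : ℝ) ≤ C * (W.conductorNorm ℤ : ℝ) ^ κ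

/-- `Poly = ∃ κ, DegAt κ` and `X = ∀ ε > 0, DegAt (2+ε)`, definitionally. -/
theorem sharpDegreeOfPolyDegree_iff_degAt :
    SharpDegreeOfPolyDegree ↔ ((∃ κ, DegAt κ) → ∀ ε : ℝ, 0 < ε → DegAt (2 + ε)) := Iff.rfl

theorem degAt_mono {κ κ' : ℝ} (h : κ ≤ κ') (hκ : DegAt κ) : DegAt κ' :=
  Summit.ABC.ABC.Theorems.SharpDegreeOfPolyDegree.Negative.degreeBound_mono h hκ

/-! ## Strengthen: the inductive (exponent-descent) form is equivalent to the crux -/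

/-- **S⁺ (strengthen-to-induct).** Every fixed-exponent degree bound descends by every fixed step:
for all `δ > 0` and `κ > 2 + δ`, `DegAt κ → DegAt (κ − δ)`. -/
def ExponentDescent : Prop :=
  ∀ δ : ℝ, 0 < δ → ∀ κ : ℝ, 2 + δ < κ → DegAt κ → DegAt (κ - δ)

/-- Iterating the descent with step `ε` from any exponent `κ ≤ 2 + ε + n ε` reaches `2 + ε`. -/
theorem degAt_two_add_of_descent (hS : ExponentDescent) {ε : ℝ} (hε : 0 < ε) :
    ∀ n : ℕ, ∀ κ : ℝ, κ ≤ 2 + ε + n * ε → DegAt κ → DegAt (2 + ε) := by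
  intro n
  induction n with
  | zero =>
      intro κ hκ h
      exact degAt_mono (by simpa using hκ) h
  | succ n ih =>
      intro κ hκ h
      by_cases hle : κ ≤ 2 + ε + n * ε
      · exact ih κ hle h
      · have hle : 2 + ε + n * ε < κ := lt_of_not_ge hle
        have hnn : (0 : ℝ) ≤ n * ε := by positivity
        have hgt : 2 + ε < κ := by linarith
        have h' : DegAt (κ - ε) := hS ε hε κ hgt h
        refine ih (κ - ε) ?_ h'
        push_cast at hκ
        linarith

/-- **S⁺ ⟹ R**: the inductive form proves the crux (descend from the antecedent's exponent in
`⌈(κ − 2 − ε)/ε⌉` steps of size `ε`). -/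
theorem sharpDegreeOfPolyDegree_of_exponentDescent (hS : ExponentDescent) :
    SharpDegreeOfPolyDegree := by
  rintro ⟨κ, hκ⟩ ε hε
  set n : ℕ := ⌈(κ - 2 - ε) / ε⌉₊ with hn
  have hle : κ ≤ 2 + ε + n * ε := by
    have h1 : (κ - 2 - ε) / ε ≤ n := Nat.le_ceil _
    have h2 : κ - 2 - ε ≤ n * ε := by
      rwa [div_le_iff₀ hε] at h1
    linarith
  exact degAt_two_add_of_descent hS hε n κ hle hκ

/-- **R ⟹ S⁺**: conversely the crux gives every descent step (under `DegAt κ` the antecedent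
holds, so `X`, so `DegAt (2 + (κ − δ − 2)) = DegAt (κ − δ)`). -/
theorem exponentDescent_of_sharpDegreeOfPolyDegree (hR : SharpDegreeOfPolyDegree) :
    ExponentDescent := by
  intro δ hδ κ hκ h
  have hX : SemistableDegreeConjecture := hR ⟨κ, h⟩
  have := hX (κ - δ - 2) (by linarith)
  have e : (2 : ℝ) + (κ - δ - 2) = κ - δ := by ring
  rw [e] at this
  exact this

/-- **The strengthen-to-induct form is the crux again**: `S⁺ ↔ R`.  The added rigidity (induction
on the exponent) buys nothing — each step is a fixed-exponent drop of the same kind. [folklore] -/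
theorem exponentDescent_iff_sharpDegreeOfPolyDegree :
    ExponentDescent ↔ SharpDegreeOfPolyDegree :=
  ⟨sharpDegreeOfPolyDegree_of_exponentDescent, exponentDescent_of_sharpDegreeOfPolyDegree⟩

/-- A single descent step with target at or below `2` is already the whole target `X`
(the free regime `κ ≤ 2` of `Negative.ExponentFloor` read upward). -/
theorem semistableDegreeConjecture_of_degAt_le_two {κ : ℝ} (hκ : κ ≤ 2) (h : DegAt κ) :
    SemistableDegreeConjecture :=
  fun ε hε => degAt_mono (by linarith) h

/-! ## Decomposition: the typed splits available are trivial seams -/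

/-- Sharp Szpiro, discriminant face only, for semistable global minimal models:
`|Δ_W| ≤ C(ε) N^{6+ε}`. -/
def DiscSharp : Prop :=
  ∀ ε : ℝ, 0 < ε → ∃ C : ℝ, ∀ (W : WeierstrassCurve ℚ) [W.IsElliptic] [W.IsGloballyMinimal]
    [NeZero (W.conductorNorm ℤ)], W.IsSemistable ℤ →
      ((|W.Δ| : ℚ) : ℝ) ≤ C * (W.conductorNorm ℤ : ℝ) ^ (6 + ε)

/-- Sub₁ of the `Δ / c₄` split: under Poly, the discriminant face of sharp Szpiro
("polynomial Szpiro ⟹ Szpiro", the crux's `Δ`-shadow; on Frey curves: polynomial abc ⟹ abc with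
exponent `3/2`). -/
def DiscSharpOfPoly : Prop := (∃ κ, DegAt κ) → DiscSharp

/-- Sub₂ of the `Δ / c₄` split: under Poly, the discriminant face implies the target (contains the
classical open "Szpiro ⟹ modified Szpiro / abc", the `c₄`-face = Hall-type statement). -/
def SharpOfDiscSharp : Prop := (∃ κ, DegAt κ) → DiscSharp → SemistableDegreeConjecture

/-- **The `Δ / c₄` split glues by a one-line seam** — so it does not isolate a piece that is easier
in kind: all difficulty sits inside the two pieces, none in the assembly. -/
theorem sharpDegreeOfPolyDegree_of_split (h₁ : DiscSharpOfPoly) (h₂ : SharpOfDiscSharp) :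
    SharpDegreeOfPolyDegree :=
  fun hP => h₂ hP (h₁ hP)

/-- **Exponent-ladder split** `Poly → DegAt κ₁ → X` (any waypoint `κ₁`): again a one-line seam, and
by `sharpDegreeOfPolyDegree_iff_forall_gt_two` the second piece is an instance of `R` itself for
every `κ₁ > 2`, while for `κ₁ ≤ 2` the first piece is all of `Poly → X`. -/
theorem sharpDegreeOfPolyDegree_of_ladder (κ₁ : ℝ) (h₁ : (∃ κ, DegAt κ) → DegAt κ₁)
    (h₂ : DegAt κ₁ → SemistableDegreeConjecture) : SharpDegreeOfPolyDegree :=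
  fun hP => h₂ (h₁ hP)

/-- The ladder's lower piece at a waypoint `κ₁ ≤ 2` is free (it is `X` by monotonicity), so the
upper piece `Poly → DegAt κ₁` is then the entire crux. -/
theorem ladder_lower_free {κ₁ : ℝ} (hκ₁ : κ₁ ≤ 2) : DegAt κ₁ → SemistableDegreeConjecture :=
  semistableDegreeConjecture_of_degAt_le_two hκ₁

/-! ## Negation: pointers (all landed) -/

/-- `¬R ↔ Poly ∧ ¬X` — a counterexample to the crux is a proof of Poly AND a refutation of the
target (hence of `ABC`, Murty 1999 Thm 1, `…OfAbc.not_abc_of_not_sharpDegreeOfPolyDegree`). -/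
example : ¬ SharpDegreeOfPolyDegree ↔ ((∃ κ, DegAt κ) ∧ ¬ SemistableDegreeConjecture) :=
  Summit.ABC.ABC.Theorems.SharpDegreeOfPolyDegree.Negative.not_sharpDegreeOfPolyDegree_iff

/-- The vacuous line: refuting the ANTECEDENT proves the crux. -/
example (h : ¬ ∃ κ, DegAt κ) : SharpDegreeOfPolyDegree :=
  Summit.ABC.ABC.Theorems.SharpDegreeOfPolyDegree.sharpDegreeOfPolyDegree_of_not_poly h

/-- The antecedent is already refuted below exponent `3/2` (Masser's semistable curves), so the
vacuous line would need Szpiro-ratio excursions beyond EVERY fixed exponent — the negation of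
polynomial Szpiro / polynomial abc on Frey curves. -/
example {κ : ℝ} (hκ : κ < 3 / 2) : ¬ DegAt κ :=
  Summit.ABC.ABC.Theorems.SharpDegreeOfPolyDegree.Negative.not_degreeBound_of_lt_three_halves hκ

end Summit.ABC.ABC.Cruxes.SharpDegreeOfPolyDegree.Strategist

end
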